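import Literature.Algebra.Polynomial.LaplacianOrthogonalInvariance
import Mathlib
import HarnessLib

/-!
# Trigonal Injectivity — the DEFINITIONS, the arithmetic anchor and the composition of the sub-skeleton
`Cruxes/ShortRootRigidity/Lines/trigonal_injectivity.lean` (planner ym-idea-3 g21, commit b8c4174ce46e; critic idea-crit-4 g10 PASS),
restated CHARACTER-IDENTICALLY in an importable Theorems module

Sub-problem `YangMills`, crux ⟨stmt-QuantumFields-23035⟩ `F4SubCurvatureDoor.ShortRootRigidity`, stub `:146 stub_oddModeRigidity` of
`Lines/aperture_bootstrap.lean` (algebraic half, E-free rational form `TrigonalInjectivityQ s`).  Cruxes modules are not importable, so the four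
stub files L1–L4 (`stub_reflection`, `stub_sectoralSpan`, `stub_EsectValues`, `stub_finish`, claimed by different seats) need ONE shared copy
of the vocabulary: `P3`, `lap`, `J3`, `Pm`, `Rf`, `flipMat`, `OhInvariant`, `TrigonalInjectivityQ`, `alpha`, `betaSq`, `Esect`, `ab`, `abMod`,
`Aval` — this file (defs block copied byte-for-byte from the sub-skeleton :31–:122, matrix facts :157–:182).  It also carries, PROVED:
the arithmetic anchor `Aval_ne_one` (`A_s ≢ 1 (mod 7)`), the matrix–vector facts at the magic point `P = (2,1,3)`, and the COMPOSITION
`trigonalInjectivityQ_of` = the sub-skeleton's `trigonalInjectivityQ_of_stubs` with the four stubs turned into HYPOTHESES (Props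
`ReflectionIdentity`, `SectoralSpan s`, `EsectValues s`, `Finish s` = the stub signatures verbatim, universally closed) — so that the by-name
target follows from the four stub files in one line.

Mathlib + `Literature.Algebra.Polynomial.LaplacianOrthogonalInvariance` only; no `sorry`; no instances, no notation.
HONEST LABEL: definitions + composition of a SUB-skeleton of the OPEN stub `:146`; `OddModeRigidity`, ⟨23035⟩, ⟨23125⟩, R2d and the
Yang–Mills mass gap remain OPEN; no summit is proved by a line.  Seat `ym-line-frs-p2` g16 (cell ym-idea-3, free hands; L1 claimant).
-/

noncomputable section

open MvPolynomial
open scoped BigOperators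
open Literature.Algebra.Polynomial

namespace Summit.QuantumFields.YangMills.Theorems.F4SubCurvatureDoorTrigonalLine
/-- real polynomials in three variables -/
abbrev P3 := MvPolynomial (Fin 3) ℝ

/-- polynomial Laplacian on `ℝ[x,y,z]` -/
def lap (Y : P3) : P3 := ∑ i : Fin 3, pderiv i (pderiv i Y)

/-- the all-ones matrix `J` -/
def J3 : Matrix (Fin 3) (Fin 3) ℝ := Matrix.of fun _ _ => 1
/-- projection onto the plane `x+y+z=0` along `(1,1,1)`:  `1 − J/3` -/
def Pm : Matrix (Fin 3) (Fin 3) ℝ := 1 - (1/3 : ℝ) • J3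
/-- reflection in the plane `x+y+z=0`:  `σ = 1 − 2J/3` (orthogonal, rational) -/
def Rf : Matrix (Fin 3) (Fin 3) ℝ := 1 - (2/3 : ℝ) • J3
/-- sign flip of coordinate `i` -/
def flipMat (i : Fin 3) : Matrix (Fin 3) (Fin 3) ℝ := Matrix.diagonal fun j => if j = i then -1 else 1

/-- full octahedral invariance `O_h = S₃ ⋉ {±1}³` -/
def OhInvariant (Y : P3) : Prop :=
  (∀ σ : Equiv.Perm (Fin 3), rename σ Y = Y) ∧ (∀ i : Fin 3, bind₁ (linSubst (flipMat i)) Y = Y)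

/-- THE TARGET (E-free rational Trigonal Injectivity at level `s`). -/
def TrigonalInjectivityQ (s : ℕ) : Prop :=
  ∀ Y : P3, Y.IsHomogeneous (6 * s) → lap Y = 0 → OhInvariant Y → lap (bind₁ (linSubst Pm) Y) = 0 → Y = 0

/-! ## The model sectoral polynomial `E_s = Re λ^{6s}`, `λ = (x−z)/2 + i (x−2y+z)/(2√3)` — rational: only `β² = (x−2y+z)²/12` occurs. -/

/-- `α = (x − z)/2` -/
def alpha : P3 := C (1/2 : ℝ) * (X 0 - X 2)
/-- `β² = (x − 2y + z)²/12` -/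
def betaSq : P3 := C (1/12 : ℝ) * (X 0 - C (2:ℝ) * X 1 + X 2) ^ 2
/-- `E_s(x,y,z) = Σ_k (−1)^k C(6s,2k) α^{6s−2k} (β²)^k = Re (α + iβ)^{6s}` -/
def Esect (s : ℕ) : P3 :=
  ∑ k ∈ Finset.range (3 * s + 1), C ((-1 : ℝ) ^ k * ((6 * s).choose (2 * k) : ℝ)) * alpha ^ (6 * s - 2 * k) * betaSq ^ k

/-! ## Arithmetic anchor (PROVED; = `Cruxes/ShortRootRigidity/TrigonalArithmetic.lean`) -/

/-- integer coordinates of `(2 + √−3)^n = (ab n).1 + (ab n).2 · √−3` -/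
def ab : ℕ → ℤ × ℤ
  | 0 => (1, 0)
  | n + 1 => (2 * (ab n).1 - 3 * (ab n).2, (ab n).1 + 2 * (ab n).2)

/-- the same recursion reduced mod `7` -/
def abMod : ℕ → ZMod 7 × ZMod 7
  | 0 => (1, 0)
  | n + 1 => (2 * (abMod n).1 - 3 * (abMod n).2, (abMod n).1 + 2 * (abMod n).2)

/-- `abMod n` is the reduction of `ab n` mod `7` -/
theorem abMod_eq_cast (n : ℕ) :
    abMod n = ((((ab n).1 : ℤ) : ZMod 7), (((ab n).2 : ℤ) : ZMod 7)) := by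
  induction n with
  | zero => rfl
  | succ k ih =>
      show (2 * (abMod k).1 - 3 * (abMod k).2, (abMod k).1 + 2 * (abMod k).2)
        = ((((2 * (ab k).1 - 3 * (ab k).2 : ℤ)) : ZMod 7), (((ab k).1 + 2 * (ab k).2 : ℤ) : ZMod 7))
      rw [ih]
      ext <;> push_cast <;> ring

/-- period `3` of the mod-`7` recursion: first instance -/
theorem abMod_four : abMod 4 = abMod 1 := by decide

/-- period `3` of the mod-`7` recursion from index `1` on -/
theorem abMod_periodic (k : ℕ) : abMod (k + 4) = abMod (k + 1) := by
  induction k with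
  | zero => exact abMod_four
  | succ k ih =>
      show (2 * (abMod (k + 4)).1 - 3 * (abMod (k + 4)).2, (abMod (k + 4)).1 + 2 * (abMod (k + 4)).2)
        = (2 * (abMod (k + 1)).1 - 3 * (abMod (k + 1)).2, (abMod (k + 1)).1 + 2 * (abMod (k + 1)).2)
      rw [ih]

/-- period `3`, iterated -/
theorem abMod_add_three_mul (k m : ℕ) : abMod (k + 1 + 3 * m) = abMod (k + 1) := by
  induction m with
  | zero => simp
  | succ m ih =>
      have h : k + 1 + 3 * (m + 1) = (k + 3 * m) + 4 := by ring
      rw [h, abMod_periodic, show k + 3 * m + 1 = k + 1 + 3 * m by ring, ih]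

/-- the value at index `3` -/
theorem abMod_three : abMod 3 = (4, 2) := by decide

/-- `(2+√−3)^{6s} ≡ 4 + 2√−3 (mod 7)` for `s ≥ 1` -/
theorem abMod_six_mul (s : ℕ) (hs : 1 ≤ s) : abMod (6 * s) = (4, 2) := by
  obtain ⟨t, rfl⟩ := Nat.exists_eq_add_of_le hs
  have h : 6 * (1 + t) = 2 + 1 + 3 * (2 * t + 1) := by ring
  rw [h, abMod_add_three_mul]
  exact abMod_three

/-- `A_s = Re (2+√−3)^{6s}` as a real number -/
def Aval (s : ℕ) : ℝ := ((ab (6 * s)).1 : ℝ)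

/-- `A_s ≠ 1` (indeed `A_s ≡ 4 (mod 7)`). PROVED. -/
theorem Aval_ne_one (s : ℕ) (hs : 1 ≤ s) : Aval s ≠ 1 := by
  intro h1
  have h1' : (ab (6 * s)).1 = 1 := by
    unfold Aval at h1
    exact_mod_cast h1
  have hmod := abMod_six_mul s hs
  rw [abMod_eq_cast, h1'] at hmod
  have h4 : ((1 : ℤ) : ZMod 7) = 4 := (Prod.mk.inj hmod).1
  revert h4
  decide

/-! ## Matrix-vector facts at the magic point `P = (2,1,3)` (PROVED) -/

/-- `σ·(2,1,3) = (−2,−3,−1)` -/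
theorem Rf_mulVec_P : Rf.mulVec ![2, 1, 3] = ![-2, -3, -1] := by
  ext i; fin_cases i <;> simp [Rf, J3, Matrix.mulVec, dotProduct, Fin.sum_univ_three, Matrix.one_apply, Matrix.sub_apply] <;> norm_num

/-- `proj·(2,1,3) = (0,−1,1)` -/
theorem Pm_mulVec_P : Pm.mulVec ![2, 1, 3] = ![0, -1, 1] := by
  ext i; fin_cases i <;> simp [Pm, J3, Matrix.mulVec, dotProduct, Fin.sum_univ_three, Matrix.one_apply, Matrix.sub_apply] <;> norm_num

/-- `proj` is the identity on the plane `x+y+z = 0` -/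
theorem Pm_mulVec_of_plane (p : Fin 3 → ℝ) (hp : p 0 + p 1 + p 2 = 0) : Pm.mulVec p = p := by
  ext i; fin_cases i <;> simp [Pm, J3, Matrix.mulVec, dotProduct, Fin.sum_univ_three, Matrix.one_apply, Matrix.sub_apply] <;> linarith

/-- sign flip of the third coordinate at `P` -/
theorem flip2_mulVec_P : (flipMat 2).mulVec ![2, 1, 3] = ![2, 1, -3] := by
  ext i; fin_cases i <;> simp [flipMat, Matrix.mulVec_diagonal]

/-- sign flip of the second coordinate at `Q = σP` -/
theorem flip1_mulVec_Q : (flipMat 1).mulVec ![-2, -3, -1] = ![-2, 3, -1] := by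
  ext i; fin_cases i <;> simp [flipMat, Matrix.mulVec_diagonal]

/-- value of `Y` at a point `p` of the plane, read through `Y∘proj = a·E_s` -/
theorem eval_plane_of_span {s : ℕ} {Y : P3} {a : ℝ} (ha : bind₁ (linSubst Pm) Y = a • Esect s)
    (p : Fin 3 → ℝ) (hp : p 0 + p 1 + p 2 = 0) : eval p Y = a * eval p (Esect s) := by
  have h := congrArg (eval p) ha
  rw [eval_bind₁_linSubst, Pm_mulVec_of_plane p hp, smul_eval] at h
  exact h


/-! ## The four stub statements as Props (signatures verbatim, universally closed) -/

/-- Statement of STUB L1 `stub_reflection` (algebraic Schwarz reflection identity). -/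
def ReflectionIdentity : Prop :=
  ∀ Y : P3, lap Y = 0 → lap (bind₁ (linSubst Pm) Y) = 0 → Y + bind₁ (linSubst Rf) Y = C (2 : ℝ) * bind₁ (linSubst Pm) Y

/-- Statement of STUB L2 `stub_sectoralSpan` at level `s`. -/
def SectoralSpan (s : ℕ) : Prop :=
  1 ≤ s → ∀ Y : P3, Y.IsHomogeneous (6 * s) → OhInvariant Y → lap (bind₁ (linSubst Pm) Y) = 0 →
    ∃ a : ℝ, bind₁ (linSubst Pm) Y = a • Esect s

/-- Statement of STUB L3 `stub_EsectValues` at level `s`. -/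
def EsectValues (s : ℕ) : Prop :=
  1 ≤ s → eval ![2, 1, -3] (Esect s) = Aval s ∧ eval ![-2, 3, -1] (Esect s) = Aval s ∧ eval ![0, -1, 1] (Esect s) = 1

/-- Statement of STUB L4 `stub_finish` at level `s`. -/
def Finish (s : ℕ) : Prop :=
  1 ≤ s → ∀ Y : P3, Y.IsHomogeneous (6 * s) → lap Y = 0 → OhInvariant Y → bind₁ (linSubst Rf) Y = -Y → Y = 0

/-! ## The composition (PROVED; the sub-skeleton's `trigonalInjectivityQ_of_stubs` with the stubs as hypotheses) -/

/-- **COMPOSITION.**  L1 ∧ L2 ∧ L3 ∧ L4 (at level `s ≥ 1`) ⇒ `TrigonalInjectivityQ s`: evaluate the reflection identity at the integer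
magic point `P = (2,1,3)` (`Rf·P = (−2,−3,−1)`, `Pm·P = (0,−1,1)`), transport `P`, `Q` into the plane by sign flips, read the three
values through the sectoral span (`a·A_s`, `a·A_s`, `a·1`), get `a(A_s − 1) = 0`, hence `a = 0` by the anchor, so `Y` is `σ`-odd and
the finish applies. -/
theorem trigonalInjectivityQ_of (s : ℕ) (hs : 1 ≤ s) (h1 : ReflectionIdentity) (h2 : SectoralSpan s) (h3 : EsectValues s)
    (h4 : Finish s) : TrigonalInjectivityQ s := by
  intro Y hY hh hO hp
  obtain ⟨a, ha⟩ := h2 hs Y hY hO hp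
  obtain ⟨hvP, hvQ, hv0⟩ := h3 hs
  have hR := h1 Y hh hp
  -- (R) evaluated at the magic point P = (2,1,3):  Y(P) + Y(Q) = 2·Y(0,−1,1)
  have e1 := congrArg (eval ![(2:ℝ), 1, 3]) hR
  rw [map_add, map_mul, eval_C, eval_bind₁_linSubst, eval_bind₁_linSubst, Rf_mulVec_P, Pm_mulVec_P] at e1
  -- transport P and Q into the plane Π_{(1,1,1)} by sign flips
  have eP : eval ![(2:ℝ), 1, 3] Y = eval ![(2:ℝ), 1, -3] Y := by
    have h := congrArg (eval ![(2:ℝ), 1, 3]) (hO.2 2)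
    rw [eval_bind₁_linSubst, flip2_mulVec_P] at h
    exact h.symm
  have eQ : eval ![(-2:ℝ), -3, -1] Y = eval ![(-2:ℝ), 3, -1] Y := by
    have h := congrArg (eval ![(-2:ℝ), -3, -1]) (hO.2 1)
    rw [eval_bind₁_linSubst, flip1_mulVec_Q] at h
    exact h.symm
  -- the three values through the sectoral span
  have vP : eval ![(2:ℝ), 1, -3] Y = a * Aval s := by
    rw [eval_plane_of_span ha _ (by simp; norm_num), hvP]
  have vQ : eval ![(-2:ℝ), 3, -1] Y = a * Aval s := by
    rw [eval_plane_of_span ha _ (by simp; norm_num), hvQ]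
  have v0 : eval ![(0:ℝ), -1, 1] Y = a * 1 := by
    rw [eval_plane_of_span ha _ (by simp), hv0]
  rw [eP, eQ, vP, vQ, v0] at e1
  -- e1 : a * A + a * A = 2 * (a * 1)  ⇒  a (A − 1) = 0  ⇒  a = 0
  have ha0 : a = 0 := by
    have hstar : a * (Aval s - 1) = 0 := by linarith
    rcases mul_eq_zero.mp hstar with h | h
    · exact h
    · exact absurd (by linarith : Aval s = 1) (Aval_ne_one s hs)
  -- hence Y∘proj = 0, so (R) says Y is σ-odd, and the finish applies
  rw [ha0, zero_smul] at ha
  rw [ha, mul_zero] at hR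
  exact h4 hs Y hY hh hO (by linear_combination hR)

end Summit.QuantumFields.YangMills.Theorems.F4SubCurvatureDoorTrigonalLine

end
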